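import Summits.QuantumFields.YangMills.Theorems.BalabanUVNodesN15KingModelBlockFieldMassGap
import Summits.QuantumFields.YangMills.Theorems.BalabanUVNodesN15KingModelContinuumDispersion
import HarnessLib

/-!
# BalabanUVNodes ∕ N15 — THE KING-MODEL RUNG (PART Ϲ, package): THE TRANSFER-MATRIX (cosh) FORM OF KING's TORUS TWO-POINT FUNCTIONS IN A TIME
# DIRECTION, THE LATTICE DISPERSION RELATION, THE FINITE-η MASS GAPS OF THE FINE FIELD AND OF THE RG BLOCK FIELD, AND THEIR η-RATES — BY NAME
# (Track A, DAG node N15 = NE2 «η-rates of the covariance pieces»; FAN-OUT v1.1 §N15 s3 «KING-MODEL RUNG»; count-neutral)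

HONEST FRAMING.  Count-neutral (cell `pub-ymgap`, seat `pub-ymgap-dag-n15-e` g38; `--supports stmt-QuantumFields-27366 --as helper` = K3⁸).
An INDEX THEOREM over this seat's PART Ϲ files (`…KingModelCycleResolvent` ∕ `…Readings` ∕ `…TorusTimeSlices` ∕ `…TorusMassGap` ∕
`…BlockFieldTimeSlices` ∕ `…BlockFieldMassGap` ∕ `…ContinuumDispersion`): the headline theorems restated BY NAME in one conjunction in KING's
UNITS (`c = η⁻² = N²`, fine torus `Ω_η = Tor (fine N M)`, unit torus `Ω = Tor M`, time axis `κ`).  TEMPLATE LITERATURE: King 1986 [King1986]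
(4.4)–(4.5) p.670, (2.13)–(2.14) p.653 (the `A = 0` operators); Montvay–Münster [MontvayMunster1994] §2.1.2 (2.18)–(2.20), (2.49) (timeslice
correlations and their transfer-matrix form), §2.2.1 (2.74)–(2.78), (2.82) (free-field energy–momentum relation, physical mass, `O(a²)`);
Drouffe–Zuber [DrouffeZuber1983] (3.43)–(3.46) p.41.  Nothing new is proved here.  NOT Bałaban's covariant objects; NOT a node discharge (N15 is
booked through n15-a's knit, untouched); no transfer operator is constructed; nothing continuum-YM ∕ ℝ⁴ ∕ OS axioms ∕ Clay.  0 `sorry`, 0 `def`.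

WHAT THIS FILE PROVES (kernel).  ★★★ **`king_torusSpectral_package`**: for `N ≥ 1`, `a > 0`, `m² > 0`, every unit torus `M`, axis `κ`:
(1) the massive cycle resolvent on `ℤ∕(N·M_κ)` in closed form; (2) the zero-momentum timeslice correlator of the fine free field
`(N²(−Δ)+m²)⁻¹` is `N^{−2}·cycleGreen`, mass `ω₀ = latticeMass(m²∕N²)` per fine step; (3) every spatial plane-wave channel is `N^{−2}·cycleGreen` at
`lapSym(p)∕N²` (the lattice dispersion relation); (4) the η-rate of the gap `0 ≤ √m² − N·ω₀ ≤ (√m²)³∕(24N²)`; (5) the RG block field's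
zero-momentum correlator is a pure `cosh` in block time with mass `N·ω₀` (`s ≠ 0`); (6) the relativistic dispersion at rate `N^{−2}` in the
Brillouin zone.

Locators: [King1986] (2.13)–(2.14) p.653, (4.4)–(4.5) p.670; [MontvayMunster1994] §2.1.2 (2.18)–(2.20), (2.49), §2.2.1 (2.74)–(2.82); [DrouffeZuber1983] (3.43)–(3.46) p.41.
-/

noncomputable section

open scoped BigOperators
open Finset Matrix Real

namespace Summit.QuantumFields.YangMills.BalabanUVNodes.N15KingModelRung.TorusSpectral

open Literature.MathematicalPhysics.QuantumFieldTheory.Balaban1983to89.B5Prop11Plancherel (Tor fine chi)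
open Literature.MathematicalPhysics.QuantumFieldTheory.King1986.Torus

variable {d : ℕ} (N : ℕ) [NeZero N] (M : Fin d → ℕ) [hM : ∀ μ, NeZero (M μ)] (κ : Fin d)

/-- ★★★ **PART Ϲ BY NAME — THE TRANSFER-MATRIX FORM OF KING's TORUS TWO-POINT FUNCTIONS, THE LATTICE DISPERSION RELATION, THE FINITE-η MASS
GAPS AND THEIR η-RATES** (King's units `c = N²`; `N ≥ 1`, `a > 0`, `m² > 0`; every unit torus and time axis):
(1) `((2+x) − S − S⁻¹)⁻¹(s,t) = cycleGreen (t − s)` on `ℤ∕(N·M_κ)` at `x = m²∕N²`;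
(2) `Σ_{z : z_κ = t} (N²(−Δ)+m²)⁻¹(z,0) = N^{−2}·cycleGreen (N·M_κ) (m²∕N²) t`;
(3) for every spatial plane wave `p` (`p_κ = 0`): `Σ_{z_κ = t} e^{ip·z}(N²(−Δ)+m²)⁻¹(z,0) = N^{−2}·cycleGreen (N·M_κ) (lapSym(p)∕N²) t`;
(4) `0 ≤ √m² − N·latticeMass(m²∕N²) ≤ (√m²)³∕(24N²)`;
(5) for `s ≠ 0`: `Σ_{b : b_κ = s} (Δ^{(K)})⁻¹(b,0) = N^{−3}(sinh(Nω₀∕2)∕sinh(ω₀∕2))²∕(2 sinh ω₀(1 − e^{−ω₀NM_κ}))·(e^{−Nω₀·val s} + e^{−Nω₀(M_κ − val s)})`;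
(6) for every physical momentum `P : Fin d → ℝ` with `|P_μ| ≤ πN`:
`0 ≤ √(m²+|P|²) − N·latticeMass(m²∕N² + Σ_μ(2−2cos(P_μ∕N))) ≤ (Σ_μP_μ⁴∕(12√(m²+|P|²)) + (m²+|P|²)^{3∕2}∕24)∕N²`.
[cite: King1986, (2.13)–(2.14) p.653, (4.4)–(4.5) p.670; MontvayMunster1994, §2.1.2 (2.18)–(2.20), (2.49), §2.2.1 (2.74)–(2.82); DrouffeZuber1983, (3.43)–(3.46) p.41] -/
theorem king_torusSpectral_package (hN1 : 1 ≤ N) {a m2 : ℝ} (ha : 0 < a) (hm : 0 < m2) :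
    (∀ s t : ZMod (fine N M κ),
        (cycleOp (fine N M κ) (m2 / (N : ℝ) ^ 2))⁻¹ s t = cycleGreen (fine N M κ) (m2 / (N : ℝ) ^ 2) (t - s))
    ∧ (∀ t : ZMod (fine N M κ),
        ∑ z : Tor (fine N M), (if z κ = t then (lapF (fine N M) ((N : ℝ) ^ 2) m2)⁻¹ z 0 else 0)
          = ((N : ℝ) ^ 2)⁻¹ * cycleGreen (fine N M κ) (m2 / (N : ℝ) ^ 2) t)
    ∧ (∀ (p : Tor (fine N M)), p κ = 0 → ∀ t : ZMod (fine N M κ),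
        ∑ z : Tor (fine N M), (if z κ = t then chi (fine N M) p z * ((lapF (fine N M) ((N : ℝ) ^ 2) m2)⁻¹ z 0 : ℂ) else 0)
          = ((((N : ℝ) ^ 2)⁻¹ * cycleGreen (fine N M κ) (lapSym (fine N M) ((N : ℝ) ^ 2) m2 p / (N : ℝ) ^ 2) t : ℝ) : ℂ))
    ∧ (0 ≤ Real.sqrt m2 - N * latticeMass (m2 / (N : ℝ) ^ 2)
        ∧ Real.sqrt m2 - N * latticeMass (m2 / (N : ℝ) ^ 2) ≤ Real.sqrt m2 ^ 3 / (24 * (N : ℝ) ^ 2))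
    ∧ (∀ s : ZMod (M κ), s ≠ 0 →
        ∑ b : Tor M, (if b κ = s then (effLaplacian N M a ((N : ℝ) ^ 2) m2)⁻¹ b 0 else 0)
          = ((N : ℝ) ^ 3)⁻¹
              * ((Real.sinh (N * latticeMass (m2 / (N : ℝ) ^ 2) / 2) / Real.sinh (latticeMass (m2 / (N : ℝ) ^ 2) / 2)) ^ 2
                / (2 * Real.sinh (latticeMass (m2 / (N : ℝ) ^ 2)) * (1 - Real.exp (-(latticeMass (m2 / (N : ℝ) ^ 2) * N * M κ)))))
              * (Real.exp (-(latticeMass (m2 / (N : ℝ) ^ 2) * N * s.val))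
                  + Real.exp (-(latticeMass (m2 / (N : ℝ) ^ 2) * N * (M κ - s.val)))))
    ∧ (∀ P : Fin d → ℝ, (∀ μ, |P μ| ≤ Real.pi * N) →
        0 ≤ Real.sqrt (m2 + ∑ μ, P μ ^ 2) - N * latticeMass (m2 / (N : ℝ) ^ 2 + ∑ μ, (2 - 2 * Real.cos (P μ / N)))
          ∧ Real.sqrt (m2 + ∑ μ, P μ ^ 2) - N * latticeMass (m2 / (N : ℝ) ^ 2 + ∑ μ, (2 - 2 * Real.cos (P μ / N)))
            ≤ ((∑ μ, P μ ^ 4) / (12 * Real.sqrt (m2 + ∑ μ, P μ ^ 2)) + Real.sqrt (m2 + ∑ μ, P μ ^ 2) ^ 3 / 24) / (N : ℝ) ^ 2) := by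
  have hNr : (0 : ℝ) < N := by exact_mod_cast Nat.pos_of_ne_zero (NeZero.ne N)
  have hN2 : (0 : ℝ) < (N : ℝ) ^ 2 := by positivity
  refine ⟨fun s t => cycleOp_inv_apply (fine N M κ) (div_pos hm hN2) s t,
    fun t => timeSlice_lapF_inv_eq_cycleGreen (fine N M) κ hN2 hm t,
    fun p hp t => timeSlice_chi_lapF_inv_eq_cycleGreen (fine N M) κ hN2 hm hp t,
    kingGap_eta_rate hNr hm.le,
    fun s hs => timeSlice_blockCov_eq_cosh' N M κ hN1 ha hm hs,
    fun P hP => latticeEnergy_eta_rate P hNr hm hP⟩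

end Summit.QuantumFields.YangMills.BalabanUVNodes.N15KingModelRung.TorusSpectral
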